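/-
Copyright (c) 2026. All rights reserved.
Released under Apache 2.0 license as described in the file LICENSE.
-/
import Literature.NumberTheory.Automorphic.MahlerCriterionPrelims

/-!
# Mahler's compactness criterion for `GL_n` over the adeles of a number field

**Theorem (Mahler's criterion, adelic form; Godement, Sém. Bourbaki 257, § 3; Borel (1969),
Prop. 8.4; Platonov–Rapinchuk (1994), Prop. 5.2).** For every `c > 0` and `b` there is a compact
subset `C ⊆ GL_n(𝔸_K)` such that every `g ∈ GL_n(𝔸_K)` whose rational row vectors are uniformly
long — `h(ξ g) ≥ c` for all `ξ ∈ Kⁿ ∖ 0`, `h` the global height of `AdelicVectorHeight` — and whose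
determinant is bounded, `|det g|_𝔸 ≤ b`, lies in `GL_n(K) · C` (`exists_isCompact_rational_mul`);
dually (transpose) for column vectors with `C · GL_n(K)` (`exists_isCompact_mul_rational`).

Proof, from the tree's Minkowski reduction `exists_minkowskiReduction` (`g = γ · u · diag(m) · k`,
`t |mᵢ₊₁| ≤ |mᵢ|`): the last Minkowski vector `e_n γ⁻¹` has `h(e_n γ⁻¹ · g) = |m_n|`, so
`|m_n| ≥ c`; the root inequalities give `|mᵢ| ≥ tⁿ c`; `∏ |mᵢ| · |det k| = |det g| ≤ b` with
`|det k|` bounded below on the compact `K` bounds each `|mᵢ|` above; hence the positive-real parts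
of the `mᵢ` live in a compact box (`MahlerCriterionPrelims`), and `N(𝔸) = N(K)·C_N`,
`M(𝔸)¹ = M(K)·C_M` finish.

## Provenance

LEAN-IN-TREE migration (class L) of the Hodge-CM cell package module
`HodgeCM/PerL34/MahlerCriterion.lean` § 4 (expansion seat pv10-g3, 2026-08-18), verbatim modulo the
namespace (`HodgeCM.PerL34.Mahler` ↦ `Literature.NumberTheory.Automorphic.Mahler`), the rename
`glTranspose ↦ transposeGL`, and the import of the tree preliminaries file.
-/

set_option autoImplicit false

noncomputable section

open scoped NNReal MatrixGroups Matrix Pointwise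
open NumberField IsDedekindDomain

namespace Literature.NumberTheory.Automorphic.Mahler

/-! ## § 4. Mahler's criterion -/

section Mahler

variable (n : ℕ) (K : Type) [Field K] [NumberField K]

/-- Mahler's criterion for `GL_{n+1}` (the inductive shape of the index type is used to speak of the
last Minkowski vector). [folklore] -/
theorem exists_isCompact_rational_mul_succ (c b : ℝ≥0) (hc : 0 < c) :
    ∃ C : Set (GL (Fin (n + 1)) (AdeleRing (𝓞 K) K)), IsCompact C ∧
      ∀ g : GL (Fin (n + 1)) (AdeleRing (𝓞 K) K),
        (∀ ξ : Fin (n + 1) → K, ξ ≠ 0 →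
          c ≤ vecHeight K (principalVec K ξ ᵥ*
            (g : Matrix (Fin (n + 1)) (Fin (n + 1)) (AdeleRing (𝓞 K) K)))) →
        IdeleClassGroup.ideleNorm K (Matrix.GeneralLinearGroup.det g) ≤ b →
        g ∈ (rationalPointsGL (n + 1) K : Set (GL (Fin (n + 1)) (AdeleRing (𝓞 K) K))) * C := by
  classical
  obtain ⟨t, ht, hred⟩ := exists_minkowskiReduction (n + 1) K
  obtain ⟨CN, hCNc, -, hCN⟩ := exists_isCompact_upperUnitriangular_adele K (n + 1)
  obtain ⟨CM, hCMc, -, hCM⟩ := exists_isCompact_normOneDiagonal_adele (n + 1) K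
  obtain ⟨κ, hκ, hκle⟩ := exists_pos_le_ideleNorm_det (n + 1) K
  -- the constants
  set t₁ : ℝ≥0 := min t.toNNReal 1 with ht₁
  have ht₁t : (t₁ : ℝ) ≤ t := by
    rw [ht₁, NNReal.coe_min, Real.coe_toNNReal t ht.le]; exact min_le_left _ _
  have ht₁1 : t₁ ≤ 1 := min_le_right _ _
  have ht₁0 : 0 < t₁ := lt_min (Real.toNNReal_pos.mpr ht) one_pos
  set ℓ : ℝ≥0 := t₁ ^ n * c with hℓ
  have hℓ0 : 0 < ℓ := mul_pos (pow_pos ht₁0 n) hc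
  set U : ℝ≥0 := b / κ / ℓ ^ n with hU
  set lo : ℝ≥0 := min ℓ 1 with hlo
  set hi : ℝ≥0 := max U 1 with hhi
  have hlo0 : lo ≠ 0 := (lt_min hℓ0 one_pos).ne'
  obtain ⟨Z, hZc, hZ⟩ := exists_isCompact_posRealDiagonal_box (n + 1) K lo hi hlo0
  set d : ℕ := Module.finrank ℚ K with hd
  have hd0 : d ≠ 0 := Module.finrank_pos.ne'
  refine ⟨CN * CM * Z *
      (standardMaximalCompactGL (n + 1) K : Set (GL (Fin (n + 1)) (AdeleRing (𝓞 K) K))),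
    ((hCNc.mul hCMc).mul hZc).mul (isCompact_standardMaximalCompactGL (n + 1) K), ?_⟩
  intro g hheight hdet
  obtain ⟨γ, u, hu, m, k, hk, hg, hroot⟩ := hred g
  -- (1) the last Minkowski vector: `c ≤ |m_n|`
  have hlast : c ≤ IdeleClassGroup.ideleNorm K (m (Fin.last n)) := by
    have hξ0 : (Pi.single (Fin.last n) (1 : K) : Fin (n + 1) → K) ≠ 0 := by
      intro h; simpa using congr_fun h (Fin.last n)
    have h := hheight _ (vecMul_ne_zero_of_ne_zero hξ0 (γ⁻¹ : GL (Fin (n + 1)) K))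
    rwa [hg, vecHeight_lastMinkowskiRow K γ hu m hk] at h
  -- the root inequalities in `ℝ≥0` with the constant `t₁ ≤ t`
  have hroot' : ∀ i j : Fin (n + 1), (j : ℕ) = (i : ℕ) + 1 →
      t₁ * IdeleClassGroup.ideleNorm K (m j) ≤ IdeleClassGroup.ideleNorm K (m i) := by
    intro i j hij
    have h := hroot i j hij
    rw [← NNReal.coe_le_coe, NNReal.coe_mul]
    exact le_trans (mul_le_mul_of_nonneg_right ht₁t (NNReal.coe_nonneg _)) h
  -- (2) lower bounds `ℓ ≤ |mᵢ|` by downward induction from the last index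
  have hstep : ∀ q : ℕ, ∀ i : Fin (n + 1), (i : ℕ) + q = n →
      t₁ ^ q * c ≤ IdeleClassGroup.ideleNorm K (m i) := by
    intro q
    induction q with
    | zero =>
      intro i hi0
      have : i = Fin.last n := Fin.ext (by simpa using hi0)
      subst this
      simpa using hlast
    | succ q ih =>
      intro i hiq
      set j : Fin (n + 1) := ⟨(i : ℕ) + 1, by omega⟩ with hj
      have hji : (j : ℕ) = (i : ℕ) + 1 := rfl
      have hjq : (j : ℕ) + q = n := by rw [hji]; omega
      calc t₁ ^ (q + 1) * c = t₁ * (t₁ ^ q * c) := by ring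
        _ ≤ t₁ * IdeleClassGroup.ideleNorm K (m j) := mul_le_mul_right (ih j hjq) _
        _ ≤ IdeleClassGroup.ideleNorm K (m i) := hroot' i j hji
  have hlow : ∀ i : Fin (n + 1), ℓ ≤ IdeleClassGroup.ideleNorm K (m i) := by
    intro i
    have hq : (i : ℕ) + (n - i) = n := by omega
    refine le_trans ?_ (hstep (n - i) i hq)
    exact mul_le_mul_left (pow_le_pow_right_of_le_one' ht₁1 (Nat.sub_le n i)) _
  -- (3) the product bound `∏ |mᵢ| ≤ b / κ`
  have hprod : (∏ i, IdeleClassGroup.ideleNorm K (m i)) ≤ b / κ := by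
    rw [le_div_iff₀ hκ]
    have h1 := ideleNorm_det_minkowski (n + 1) K γ hu m k
    rw [← hg] at h1
    calc (∏ i, IdeleClassGroup.ideleNorm K (m i)) * κ
        ≤ (∏ i, IdeleClassGroup.ideleNorm K (m i)) *
            IdeleClassGroup.ideleNorm K (Matrix.GeneralLinearGroup.det k) :=
          mul_le_mul_right (hκle k hk) _
      _ = IdeleClassGroup.ideleNorm K (Matrix.GeneralLinearGroup.det g) := h1.symm
      _ ≤ b := hdet
  -- (4) upper bounds `|mᵢ| ≤ U`
  have hupp : ∀ i : Fin (n + 1), IdeleClassGroup.ideleNorm K (m i) ≤ U := by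
    intro i
    rw [hU, le_div_iff₀ (pow_pos hℓ0 n)]
    refine le_trans ?_ hprod
    have hcard : (Finset.univ.erase i).card = n := by
      rw [Finset.card_erase_of_mem (Finset.mem_univ i), Finset.card_univ, Fintype.card_fin]; rfl
    calc IdeleClassGroup.ideleNorm K (m i) * ℓ ^ n
        ≤ IdeleClassGroup.ideleNorm K (m i) *
            ∏ j ∈ Finset.univ.erase i, IdeleClassGroup.ideleNorm K (m j) := by
          refine mul_le_mul_right ?_ _
          have h := Finset.pow_card_le_prod (Finset.univ.erase i)
            (fun j => IdeleClassGroup.ideleNorm K (m j)) ℓ fun j _ => hlow j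
          rwa [hcard] at h
      _ = ∏ j, IdeleClassGroup.ideleNorm K (m j) :=
          Finset.mul_prod_erase Finset.univ (fun j => IdeleClassGroup.ideleNorm K (m j))
            (Finset.mem_univ i)
  -- (5) split `mᵢ = mᵢ¹ z(rᵢ)` and bound the real parameters: `lo ≤ rᵢ ≤ hi`
  choose m₁ hm₁ r hmr using fun i => exists_normOneIdeles_mul_posRealIdele (K := K) (m i)
  have hnorm : ∀ i, IdeleClassGroup.ideleNorm K (m i) = (r i : ℝ≥0) ^ d := by
    intro i
    rw [hmr i, map_mul, mem_normOneIdeles.mp (hm₁ i), one_mul, ideleNorm_posRealIdele_holds K (r i)]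
  have hr : ∀ i, lo ≤ (r i : ℝ≥0) ∧ (r i : ℝ≥0) ≤ hi := by
    intro i
    rcases le_total (r i : ℝ≥0) 1 with h1 | h1
    · refine ⟨le_trans (min_le_left _ _) ?_, le_trans h1 (le_max_right _ _)⟩
      exact le_trans (hlow i) (by rw [hnorm i]; exact pow_le_of_le_one zero_le h1 hd0)
    · refine ⟨le_trans (min_le_right _ _) h1, le_trans ?_ (le_max_left _ _)⟩
      exact le_trans (by rw [hnorm i]; exact le_self_pow₀ h1 hd0) (hupp i)
  have hZmem : posRealDiagonal (n + 1) K r ∈ Z := hZ r hr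
  -- (6) the rearrangement `g = (γ δ ν) · (c_N c z(r) k)`
  have hdiag : glDiagonal (n + 1) (AdeleRing (𝓞 K) K) m =
      glDiagonal (n + 1) (AdeleRing (𝓞 K) K) m₁ * posRealDiagonal (n + 1) K r := by
    have hm : m = m₁ * fun i => posRealIdele K (r i) := funext fun i => by rw [Pi.mul_apply, hmr i]
    rw [hm, map_mul, ← posRealDiagonal_apply]
  have hm₁mem : glDiagonal (n + 1) (AdeleRing (𝓞 K) K) m₁ ∈ normOneDiagonal (n + 1) K :=
    mem_normOneDiagonal_iff.mpr ⟨m₁, fun i => mem_normOneIdeles.mp (hm₁ i), rfl⟩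
  obtain ⟨κ', cM, hcM, hδc⟩ := hCM _ hm₁mem
  set δ : GL (Fin (n + 1)) (AdeleRing (𝓞 K) K) :=
    glDiagonal (n + 1) (AdeleRing (𝓞 K) K) (fun i => principalIdele K (κ' i)) with hδ
  have hu' : δ⁻¹ * u * δ ∈ upperUnitriangular (Fin (n + 1)) (AdeleRing (𝓞 K) K) :=
    glDiagonal_inv_mul_mul_glDiagonal_mem_upperUnitriangular _ hu
  obtain ⟨ν, -, cN, hcN, hν⟩ := hCN _ hu'
  set γ' : GL (Fin (n + 1)) (AdeleRing (𝓞 K) K) :=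
    Matrix.GeneralLinearGroup.map (algebraMap K (AdeleRing (𝓞 K) K)) γ with hγ'
  set ν' : GL (Fin (n + 1)) (AdeleRing (𝓞 K) K) :=
    Matrix.GeneralLinearGroup.map (algebraMap K (AdeleRing (𝓞 K) K)) ν with hν'
  set z : GL (Fin (n + 1)) (AdeleRing (𝓞 K) K) := posRealDiagonal (n + 1) K r with hz
  have huδ : u * δ = δ * (ν' * cN) := by
    rw [← hν]
    simp only [mul_assoc, mul_inv_cancel_left]
  have hgeq : g = γ' * δ * ν' * (cN * cM * z * k) :=
    calc g = γ' * u * (δ * cM * z) * k := by rw [hg, hdiag, hδc]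
      _ = γ' * (u * δ) * cM * z * k := by simp only [mul_assoc]
      _ = γ' * (δ * (ν' * cN)) * cM * z * k := by rw [huδ]
      _ = γ' * δ * ν' * (cN * cM * z * k) := by simp only [mul_assoc]
  have hrat : γ' * δ * ν' ∈ rationalPointsGL (n + 1) K :=
    Subgroup.mul_mem _ (Subgroup.mul_mem _ ⟨γ, rfl⟩
      (glDiagonal_principalIdele_mem_rationalPointsGL (n + 1) K κ')) ⟨ν, rfl⟩
  rw [hgeq]
  exact Set.mul_mem_mul hrat (Set.mul_mem_mul (Set.mul_mem_mul (Set.mul_mem_mul hcN hcM) hZmem) hk)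

/-- **Mahler's compactness criterion** (adelic `GL_n`, row vectors): for `c > 0` and `b` there is
a compact `C ⊆ GL_n(𝔸_K)` with `{g : h(ξ g) ≥ c ∀ ξ ∈ Kⁿ ∖ 0, |det g|_𝔸 ≤ b} ⊆ GL_n(K) · C`.
[cite: Godement1964, §3, Thm. 3] [cite: Borel1969, Prop. 8.4]
[cite: PlatonovRapinchuk1994, Prop. 5.2] -/
theorem exists_isCompact_rational_mul (c b : ℝ≥0) (hc : 0 < c) :
    ∃ C : Set (GL (Fin n) (AdeleRing (𝓞 K) K)), IsCompact C ∧
      ∀ g : GL (Fin n) (AdeleRing (𝓞 K) K),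
        (∀ ξ : Fin n → K, ξ ≠ 0 →
          c ≤ vecHeight K (principalVec K ξ ᵥ* (g : Matrix (Fin n) (Fin n) (AdeleRing (𝓞 K) K)))) →
        IdeleClassGroup.ideleNorm K (Matrix.GeneralLinearGroup.det g) ≤ b →
        g ∈ (rationalPointsGL n K : Set (GL (Fin n) (AdeleRing (𝓞 K) K))) * C := by
  cases n with
  | zero =>
    refine ⟨{1}, isCompact_singleton, fun g _ _ => ?_⟩
    have hg : g = 1 := Matrix.GeneralLinearGroup.ext fun i _ => i.elim0
    rw [hg]
    exact Set.mem_mul.mpr ⟨1, Subgroup.one_mem _, 1, Set.mem_singleton 1, mul_one 1⟩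
  | succ n => exact exists_isCompact_rational_mul_succ n K c b hc

/-- **Mahler's compactness criterion, column / right version**: for `c > 0` and `b` there is a
compact `C ⊆ GL_n(𝔸_K)` with `{g : h(g ξ) ≥ c ∀ ξ ∈ Kⁿ ∖ 0, |det g|_𝔸 ≤ b} ⊆ C · GL_n(K)`
(transpose of the row version). [cite: Godement1964, §3, Thm. 3] [cite: Borel1969, Prop. 8.4] -/
theorem exists_isCompact_mul_rational (c b : ℝ≥0) (hc : 0 < c) :
    ∃ C : Set (GL (Fin n) (AdeleRing (𝓞 K) K)), IsCompact C ∧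
      ∀ g : GL (Fin n) (AdeleRing (𝓞 K) K),
        (∀ ξ : Fin n → K, ξ ≠ 0 →
          c ≤ vecHeight K ((g : Matrix (Fin n) (Fin n) (AdeleRing (𝓞 K) K)) *ᵥ principalVec K ξ)) →
        IdeleClassGroup.ideleNorm K (Matrix.GeneralLinearGroup.det g) ≤ b →
        g ∈ C * (rationalPointsGL n K : Set (GL (Fin n) (AdeleRing (𝓞 K) K))) := by
  obtain ⟨C, hC, hmem⟩ := exists_isCompact_rational_mul n K c b hc
  refine ⟨transposeGL '' C, hC.image continuous_transposeGL, fun g hheight hdet => ?_⟩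
  have h := hmem (transposeGL g) (fun ξ hξ => by rw [vecMul_transposeGL]; exact hheight ξ hξ)
    (by rw [det_transposeGL]; exact hdet)
  obtain ⟨ρ, ⟨γ, hγ⟩, k, hk, hρk⟩ := Set.mem_mul.mp h
  have hg : g = transposeGL k * transposeGL ρ := by
    rw [← transposeGL_mul, hρk, transposeGL_transposeGL]
  rw [hg]
  refine Set.mul_mem_mul ⟨k, hk, rfl⟩ ⟨transposeGL γ, ?_⟩
  rw [← hγ, transposeGL_map]

end Mahler

end Literature.NumberTheory.Automorphic.Mahler
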